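import Literature.NumberTheory.LFunctions.RudnickSarnakNMainTerm
import Literature.NumberTheory.LFunctions.MertensSecondLogPower
import Mathlib.NumberTheory.AbelSummation
import Mathlib.Analysis.Calculus.Deriv.Support
import HarnessLib

/-!
# Rudnick–Sarnak `n`-level correlations for `ζ`, XIII: the prime pair sum via the prime number theorem

Sibling file of `Literature/NumberTheory/LFunctions/RudnickSarnak.lean` (toward
`Literature.NumberTheory.LFunctions.rudnick_sarnak_unrestricted` at every level). The prime pair
sum of `RudnickSarnakNMainTerm.lean`,

  `𝒫(x, y) = Σ_p (log²p/p) g₀(log p − x) g₀(log p − y)`   (`RudnickSarnakN.primePairFull`),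

is evaluated by partial summation from `ϑ(t) = t + O(t/log²t)` (the tree's PROVED prime number
theorem with error term, `exists_abs_theta_sub_le_div_log_pow`): uniformly in `x ∈ ℝ`, `y ≥ 0`,

  `𝒫(x, y) = y · K(x − y) + O(1)`,  `K(w) = ∫ g₀(z) g₀(z + w) dz`
  (`RudnickSarnakN.abs_primePairFull_sub_le`, `RudnickSarnakN.Kfun`).

This is Rudnick–Sarnak 1996, (3.66)–(3.68): "by the Prime Number Theorem … `Σ_p (log²p/p)
g(log p/L − ξ)… = L ∫ … + O(1)`" (their `T^{η}`-smoothing replaced by the compactly supported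
`g₀`).

## References

* Z. Rudnick, P. Sarnak, *Zeros of principal `L`-functions and random matrix theory*, Duke Math.
  J. 81 (1996), 269–322, (3.66)–(3.68).
* H. L. Montgomery, R. C. Vaughan, *Multiplicative Number Theory I*, CUP 2007, Thm 6.9.
-/

noncomputable section

open Complex Filter Set MeasureTheory Finset
open ArithmeticFunction (vonMangoldt_nonneg vonMangoldt_apply_prime vonMangoldt_le_log)
open scoped Real Topology ArithmeticFunction.vonMangoldt Chebyshev ContDiff

namespace Literature.NumberTheory.LFunctions

namespace RudnickSarnakN

open Literature.NumberTheory.LFunctions.Mertens (exists_abs_theta_sub_le_div_log_pow measurable_theta abs_theta_sub_self_le)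

/-! ## The real kernel `g₀` and its derivative -/

/-- `g₀` as a real function. [folklore] -/
def g0R (v : ℝ) : ℝ := (g0 v).re

/-- `g0R` is smooth. [folklore] -/
theorem contDiff_g0R : ContDiff ℝ ∞ g0R :=
  Complex.reCLM.contDiff.comp g0_isWeilTest.1

/-- `g0R` has compact support. [folklore] -/
theorem hasCompactSupport_g0R : HasCompactSupport g0R := by
  refine HasCompactSupport.of_support_subset_isCompact (isCompact_Icc (a := -(1 / 4 : ℝ)) (b := 1 / 4)) ?_
  intro v hv
  rw [Function.mem_support] at hv
  by_contra h
  apply hv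
  unfold g0R
  rw [g0_eq_zero, Complex.zero_re]
  rw [Set.mem_Icc, not_and_or, not_le, not_le] at h
  rcases h with h | h
  · rw [abs_of_neg (by linarith)]; linarith
  · rw [abs_of_pos (by linarith)]; linarith

/-- `g0R` is continuous, differentiable. [folklore] -/
theorem differentiable_g0R : Differentiable ℝ g0R := contDiff_g0R.differentiable (by simp)

/-- `g0R(v) = 0` for `|v| ≥ 1/4`. [folklore] -/
theorem g0R_eq_zero {v : ℝ} (hv : 1 / 4 ≤ |v|) : g0R v = 0 := by
  unfold g0R; rw [g0_eq_zero hv, Complex.zero_re]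

/-- `0 ≤ g0R ≤ ∫φ`. [folklore] -/
theorem g0R_nonneg (v : ℝ) : 0 ≤ g0R v := g0_re_nonneg v

/-- `g0R ≤ ∫φ`. [folklore] -/
theorem g0R_le (v : ℝ) : g0R v ≤ bumpMass := g0_re_le v

/-- `g0R` is even. [folklore] -/
theorem g0R_neg (v : ℝ) : g0R (-v) = g0R v := by unfold g0R; rw [g0_neg]

/-- `∫ g0R = κ(0)`. [folklore] -/
theorem integral_g0R : ∫ v, g0R v = ker 0 := by
  have h := ker_zero_eq
  have h2 : (∫ v : ℝ, g0 v).re = ∫ v, (g0 v).re := re_integral_eq integrable_g0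
  rw [← h] at h2
  simpa [g0R] using h2.symm

/-- `g0R` is integrable. [folklore] -/
theorem integrable_g0R : Integrable g0R := by
  unfold g0R; exact integrable_g0.re

/-- **A bound for `g0R'`.** [folklore] -/
theorem exists_deriv_g0R_le : ∃ M₁ : ℝ, 0 ≤ M₁ ∧ ∀ v, |deriv g0R v| ≤ M₁ := by
  have hc : Continuous (deriv g0R) := contDiff_g0R.continuous_deriv (by simp)
  obtain ⟨C, hC⟩ := hc.bounded_above_of_compact_support hasCompactSupport_g0R.deriv
  refine ⟨max C 0, le_max_right _ _, fun v ↦ ?_⟩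
  have := hC v
  rw [Real.norm_eq_abs] at this
  exact this.trans (le_max_left _ _)

/-- The derivative bound `M₁`. [folklore] -/
def derivBound : ℝ := Classical.choose exists_deriv_g0R_le

/-- Specification of `derivBound`. [folklore] -/
theorem derivBound_spec : 0 ≤ derivBound ∧ ∀ v, |deriv g0R v| ≤ derivBound := Classical.choose_spec exists_deriv_g0R_le

/-- `g0R'(v) = 0` for `|v| > 1/4` (locally zero). [folklore] -/
theorem deriv_g0R_eq_zero {v : ℝ} (hv : 1 / 4 < |v|) : deriv g0R v = 0 := by
  have h : g0R =ᶠ[𝓝 v] fun _ ↦ 0 := by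
    have hopen : IsOpen {w : ℝ | 1 / 4 < |w|} := isOpen_lt continuous_const continuous_abs
    filter_upwards [hopen.mem_nhds hv] with w hw
    exact g0R_eq_zero hw.le
  rw [h.deriv_eq]; simp

/-- Lipschitz bound: `|g0R(a) − g0R(b)| ≤ M₁ |a − b|`. [folklore] -/
theorem abs_g0R_sub_le (a b : ℝ) : |g0R a - g0R b| ≤ derivBound * |a - b| := by
  have h := Convex.norm_image_sub_le_of_norm_deriv_le (f := g0R) (fun v _ ↦ differentiable_g0R v)
    (fun v _ ↦ by rw [Real.norm_eq_abs]; exact derivBound_spec.2 v) convex_univ (Set.mem_univ b) (Set.mem_univ a)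
  rwa [Real.norm_eq_abs, Real.norm_eq_abs] at h

/-! ## The autocorrelation kernel `K` -/

/-- **`K(w) = ∫ g₀(z) g₀(z + w) dz`** (the pair density kernel, `= g₀ ⋆ g₀`). [cite: RudnickSarnak1996, (3.68)] -/
def Kfun (w : ℝ) : ℝ := ∫ z, g0R z * g0R (z + w)

/-- Integrability of `z ↦ g0R z g0R(z + w)`. [folklore] -/
theorem integrable_g0R_mul_shift (w : ℝ) : Integrable fun z ↦ g0R z * g0R (z + w) := by
  have h := integrable_g0R.bdd_mul (c := bumpMass) (f := fun z ↦ g0R (z + w))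
    (contDiff_g0R.continuous.comp (continuous_id.add continuous_const)).aestronglyMeasurable
    (Eventually.of_forall fun z ↦ by rw [Real.norm_eq_abs, abs_of_nonneg (g0R_nonneg _)]; exact g0R_le _)
  refine h.congr (Eventually.of_forall fun z ↦ ?_)
  simp [mul_comm]

/-- `K ≥ 0`. [folklore] -/
theorem Kfun_nonneg (w : ℝ) : 0 ≤ Kfun w := integral_nonneg fun _ ↦ mul_nonneg (g0R_nonneg _) (g0R_nonneg _)

/-- `K(w) ≤ ∫φ · κ(0)`. [folklore] -/
theorem Kfun_le (w : ℝ) : Kfun w ≤ bumpMass * ker 0 := by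
  unfold Kfun
  calc ∫ z, g0R z * g0R (z + w) ≤ ∫ z, g0R z * bumpMass :=
        integral_mono (integrable_g0R_mul_shift w) (integrable_g0R.mul_const _) fun z ↦
          mul_le_mul_of_nonneg_left (g0R_le _) (g0R_nonneg _)
    _ = bumpMass * ker 0 := by rw [integral_mul_const, integral_g0R, mul_comm]

/-- `K` is even. [folklore] -/
theorem Kfun_neg (w : ℝ) : Kfun (-w) = Kfun w := by
  unfold Kfun
  have h : ∫ z, g0R z * g0R (z + -w) = ∫ z, g0R (z + w) * g0R (z + w + -w) :=
    (integral_add_right_eq_self (fun z ↦ g0R z * g0R (z + -w)) w).symm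
  rw [h]
  congr 1 with z
  rw [show z + w + -w = z by ring, mul_comm]

/-- `K(w) = 0` for `|w| ≥ 1/2`. [folklore] -/
theorem Kfun_eq_zero {w : ℝ} (hw : 1 / 2 ≤ |w|) : Kfun w = 0 := by
  unfold Kfun
  refine integral_eq_zero_of_ae (Eventually.of_forall fun z ↦ ?_)
  simp only [Pi.zero_apply]
  by_cases hz : 1 / 4 ≤ |z|
  · rw [g0R_eq_zero hz, zero_mul]
  · rw [g0R_eq_zero (v := z + w), mul_zero]
    rcases abs_cases w with ⟨h1, _⟩ | ⟨h1, _⟩ <;> rcases abs_cases z with ⟨h3, _⟩ | ⟨h3, _⟩ <;>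
      rcases abs_cases (z + w) with ⟨h5, _⟩ | ⟨h5, _⟩ <;> push Not at hz <;> linarith

/-- `∫ g0R(u − x) g0R(u − y) du = K(x − y)`. [folklore] -/
theorem integral_g0R_sub_mul_g0R_sub (x y : ℝ) : ∫ u, g0R (u - x) * g0R (u - y) = Kfun (x - y) := by
  unfold Kfun
  rw [← integral_sub_right_eq_self (fun z ↦ g0R z * g0R (z + (x - y))) x]
  congr 1 with u
  rw [show u - x + (x - y) = u - y by ring]

/-- Lipschitz continuity of `K`: `|K(a) − K(b)| ≤ M₁ κ(0) |a − b|`. [folklore] -/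
theorem abs_Kfun_sub_le (a b : ℝ) : |Kfun a - Kfun b| ≤ derivBound * ker 0 * |a - b| := by
  unfold Kfun
  rw [← integral_sub (integrable_g0R_mul_shift a) (integrable_g0R_mul_shift b)]
  calc |∫ z, (g0R z * g0R (z + a) - g0R z * g0R (z + b))| ≤ ∫ z, |g0R z * g0R (z + a) - g0R z * g0R (z + b)| := by
        have := norm_integral_le_integral_norm (fun z ↦ g0R z * g0R (z + a) - g0R z * g0R (z + b)) (μ := volume)
        simpa only [Real.norm_eq_abs] using this
    _ ≤ ∫ z, g0R z * (derivBound * |a - b|) := by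
        refine integral_mono_of_nonneg (Eventually.of_forall fun z ↦ abs_nonneg _) (integrable_g0R.mul_const _)
          (Eventually.of_forall fun z ↦ ?_)
        dsimp only
        rw [← mul_sub, abs_mul, abs_of_nonneg (g0R_nonneg z)]
        refine mul_le_mul_of_nonneg_left ?_ (g0R_nonneg z)
        have := abs_g0R_sub_le (z + a) (z + b)
        rwa [show z + a - (z + b) = a - b by ring] at this
    _ = derivBound * ker 0 * |a - b| := by rw [integral_mul_const, integral_g0R]; ring

/-- `K` is continuous. [folklore] -/
theorem continuous_Kfun : Continuous Kfun := by
  have hL : LipschitzWith ⟨derivBound * ker 0, mul_nonneg derivBound_spec.1 ker_zero_pos.le⟩ Kfun :=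
    LipschitzWith.of_dist_le_mul fun a b ↦ by
      rw [Real.dist_eq, Real.dist_eq]
      exact abs_Kfun_sub_le a b
  exact hL.continuous

/-! ## The full prime pair sum and the partial-summation set-up -/

/-- The prime pair sum over all primes (finite: `c_y(p) = 0` for `p > N_y`):
`𝒫(x, y) = Σ_{p ≤ N_y} c_x(p) c_y(p)`. [cite: RudnickSarnak1996, (3.66)] -/
def primePairFull (x y : ℝ) : ℝ :=
  ∑ m ∈ Finset.Icc 1 (suppBound y), if m.Prime then coefR x m * coefR y m else 0

/-- For `y ≤ 2 log T` the `T`-truncated pair sum is the full one. [folklore] -/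
theorem primePair_eq_primePairFull {T x y : ℝ} (hy : y ≤ 2 * Real.log T) : primePair T x y = primePairFull x y := by
  unfold primePair primePairFull primeBound
  symm
  refine Finset.sum_subset (Finset.Icc_subset_Icc_right (suppBound_mono hy)) fun m hm hm' ↦ ?_
  rw [Finset.mem_Icc] at hm hm'
  have : suppBound y < m := by omega
  rw [coefR_eq_zero_of_suppBound_lt this, mul_zero, ite_self]

/-- The smooth weight `h(u) = g₀(u − x) g₀(u − y)`. [folklore] -/
def hWeight (x y u : ℝ) : ℝ := g0R (u - x) * g0R (u - y)

/-- Its derivative. [folklore] -/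
def hWeightDeriv (x y u : ℝ) : ℝ := deriv g0R (u - x) * g0R (u - y) + g0R (u - x) * deriv g0R (u - y)

/-- `HasDerivAt h h' u`. [folklore] -/
theorem hasDerivAt_hWeight (x y u : ℝ) : HasDerivAt (hWeight x y) (hWeightDeriv x y u) u := by
  unfold hWeight hWeightDeriv
  have h1 : HasDerivAt (fun u ↦ g0R (u - x)) (deriv g0R (u - x)) u :=
    HasDerivAt.comp_sub_const u x (differentiable_g0R (u - x)).hasDerivAt
  have h2 : HasDerivAt (fun u ↦ g0R (u - y)) (deriv g0R (u - y)) u :=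
    HasDerivAt.comp_sub_const u y (differentiable_g0R (u - y)).hasDerivAt
  exact h1.mul h2

/-- `|h| ≤ (∫φ)²` and `0 ≤ h`. [folklore] -/
theorem hWeight_mem (x y u : ℝ) : 0 ≤ hWeight x y u ∧ hWeight x y u ≤ bumpMass ^ 2 := by
  unfold hWeight
  refine ⟨mul_nonneg (g0R_nonneg _) (g0R_nonneg _), ?_⟩
  rw [sq]; exact mul_le_mul (g0R_le _) (g0R_le _) (g0R_nonneg _) bumpMass_pos.le

/-- `h ≤ ∫φ · g₀(u − y)`. [folklore] -/
theorem hWeight_le' (x y u : ℝ) : hWeight x y u ≤ bumpMass * g0R (u - y) :=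
  mul_le_mul_of_nonneg_right (g0R_le _) (g0R_nonneg _)

/-- `h(u) = 0` unless `|u − y| < 1/4`. [folklore] -/
theorem hWeight_eq_zero {x y u : ℝ} (hu : 1 / 4 ≤ |u - y|) : hWeight x y u = 0 := by
  unfold hWeight; rw [g0R_eq_zero hu, mul_zero]

/-- `h'(u) = 0` unless `|u − y| ≤ 1/4`. [folklore] -/
theorem hWeightDeriv_eq_zero {x y u : ℝ} (hu : 1 / 4 < |u - y|) : hWeightDeriv x y u = 0 := by
  unfold hWeightDeriv; rw [g0R_eq_zero hu.le, deriv_g0R_eq_zero hu, mul_zero, mul_zero, add_zero]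

/-- `|h'| ≤ 2 ∫φ M₁`. [folklore] -/
theorem abs_hWeightDeriv_le (x y u : ℝ) : |hWeightDeriv x y u| ≤ 2 * bumpMass * derivBound := by
  unfold hWeightDeriv
  have h1 := derivBound_spec.2 (u - x)
  have h2 := derivBound_spec.2 (u - y)
  have h3 := g0R_le (u - y); have h4 := g0R_le (u - x)
  have h5 := g0R_nonneg (u - y); have h6 := g0R_nonneg (u - x)
  calc |deriv g0R (u - x) * g0R (u - y) + g0R (u - x) * deriv g0R (u - y)|
      ≤ |deriv g0R (u - x)| * g0R (u - y) + g0R (u - x) * |deriv g0R (u - y)| := by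
        refine (abs_add_le _ _).trans (le_of_eq ?_)
        rw [abs_mul, abs_mul, abs_of_nonneg h5, abs_of_nonneg h6]
    _ ≤ derivBound * bumpMass + bumpMass * derivBound :=
        add_le_add (mul_le_mul h1 h3 h5 derivBound_spec.1) (mul_le_mul h4 h2 (abs_nonneg _) bumpMass_pos.le)
    _ = 2 * bumpMass * derivBound := by ring

/-- The Abel weight `F(t) = (log t/t) h(log t)`. [folklore] -/
def abelF (x y t : ℝ) : ℝ := Real.log t / t * hWeight x y (Real.log t)

/-- Its derivative for `t > 0`. [folklore] -/
def abelFDeriv (x y t : ℝ) : ℝ :=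
  (hWeightDeriv x y (Real.log t) * Real.log t + hWeight x y (Real.log t) * (1 - Real.log t)) / t ^ 2

/-- `HasDerivAt F F'(t) t` for `t > 0`. [folklore] -/
theorem hasDerivAt_abelF (x y : ℝ) {t : ℝ} (ht : 0 < t) : HasDerivAt (abelF x y) (abelFDeriv x y t) t := by
  unfold abelF abelFDeriv
  have hlog : HasDerivAt Real.log t⁻¹ t := Real.hasDerivAt_log ht.ne'
  have h1 : HasDerivAt (fun s ↦ Real.log s / s) ((t⁻¹ * t - Real.log t * 1) / t ^ 2) t :=
    hlog.div (hasDerivAt_id t) ht.ne'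
  have h2 : HasDerivAt (fun s ↦ hWeight x y (Real.log s)) (hWeightDeriv x y (Real.log t) * t⁻¹) t :=
    (hasDerivAt_hWeight x y (Real.log t)).comp t hlog
  refine (h1.mul h2).congr_deriv ?_
  field_simp
  ring

/-- For a prime `p`, `c_x(p) c_y(p) = F(p) log p`. [folklore] -/
theorem coefR_mul_coefR_prime (x y : ℝ) {p : ℕ} (hp : p.Prime) :
    coefR x p * coefR y p = abelF x y p * Real.log p := by
  unfold coefR abelF hWeight g0R
  rw [vonMangoldt_apply_prime hp]
  have hp0 : (0 : ℝ) < p := by exact_mod_cast hp.pos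
  have hs : Real.sqrt p * Real.sqrt p = p := Real.mul_self_sqrt hp0.le
  rw [show Real.log p / Real.sqrt p * (g0 (Real.log p - x)).re * (Real.log p / Real.sqrt p * (g0 (Real.log p - y)).re) =
    Real.log p * Real.log p / (Real.sqrt p * Real.sqrt p) * ((g0 (Real.log p - x)).re * (g0 (Real.log p - y)).re) by ring, hs]
  field_simp

/-! ## The evaluation by partial summation -/

/-- `(1 + log t) ≤ 4 log² t` for `t ≥ 2`. [folklore] -/
theorem one_add_log_le {t : ℝ} (ht : 2 ≤ t) : 1 + Real.log t ≤ 4 * Real.log t ^ 2 := by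
  have h2 : (0.6931471803 : ℝ) < Real.log 2 := Real.log_two_gt_d9
  have hl : Real.log 2 ≤ Real.log t := Real.log_le_log (by norm_num) ht
  nlinarith

/-- The constant of the prime pair evaluation. [folklore] -/
def primePairConst : ℝ :=
  bumpMass * ker 0 / 4 + bumpMass ^ 2 + 2 * Classical.choose (exists_abs_theta_sub_le_div_log_pow 2) *
    (bumpMass ^ 2 + 2 * bumpMass * derivBound) + 7 * bumpMass ^ 2 + bumpMass * ker 0

/-- `primePairConst ≥ 0`. [folklore] -/
theorem primePairConst_nonneg : 0 ≤ primePairConst := by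
  unfold primePairConst
  have := bumpMass_pos; have := ker_zero_pos; have := derivBound_spec.1
  have := (Classical.choose_spec (exists_abs_theta_sub_le_div_log_pow 2)).1
  positivity

/-- The small-`y` case: `|𝒫(x, y)| ≤ 7 (∫φ)²` for `0 ≤ y ≤ 1`. [folklore] -/
theorem abs_primePairFull_le_of_le_one (x : ℝ) {y : ℝ} (hy0 : 0 ≤ y) (hy1 : y ≤ 1) :
    |primePairFull x y| ≤ 7 * bumpMass ^ 2 := by
  classical
  set N := suppBound y
  have hlogN : Real.log N ≤ y + 1 / 4 := by
    rcases Nat.eq_zero_or_pos N with h0 | hpos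
    · rw [h0]; simp; linarith
    · calc Real.log N ≤ Real.log (Real.exp (y + 1 / 4)) := Real.log_le_log (by exact_mod_cast hpos) (suppBound_le y)
        _ = y + 1 / 4 := Real.log_exp _
  have hlogN0 : 0 ≤ Real.log (N : ℝ) := Real.log_natCast_nonneg N
  have hterm : ∀ m ∈ Finset.Icc 1 N, |(if m.Prime then coefR x m * coefR y m else 0)| ≤ bumpMass ^ 2 * ((y + 1 / 4) * ((Λ m : ℝ) / m)) := by
    intro m hm
    rw [Finset.mem_Icc] at hm
    have hm0 : (0 : ℝ) < m := by exact_mod_cast hm.1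
    split_ifs with hp
    · rw [abs_of_nonneg (mul_nonneg (coefR_nonneg _ _) (coefR_nonneg _ _))]
      have h1 := coefR_le x m; have h2 := coefR_le y m
      have hΛ : (Λ m : ℝ) ≤ y + 1 / 4 := by
        refine vonMangoldt_le_log.trans ((Real.log_le_log hm0 (by exact_mod_cast hm.2)).trans hlogN)
      calc coefR x m * coefR y m ≤ (bumpMass * (Λ m / Real.sqrt m)) * (bumpMass * (Λ m / Real.sqrt m)) :=
            mul_le_mul h1 h2 (coefR_nonneg _ _) ((coefR_nonneg _ _).trans h1)
        _ = bumpMass ^ 2 * (Λ m * ((Λ m : ℝ) / m)) := by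
            rw [show bumpMass * ((Λ m : ℝ) / Real.sqrt m) * (bumpMass * ((Λ m : ℝ) / Real.sqrt m)) =
              bumpMass ^ 2 * ((Λ m : ℝ) * (Λ m : ℝ) / (Real.sqrt m * Real.sqrt m)) by ring, Real.mul_self_sqrt hm0.le]
            ring
        _ ≤ bumpMass ^ 2 * ((y + 1 / 4) * ((Λ m : ℝ) / m)) := by
            refine mul_le_mul_of_nonneg_left (mul_le_mul_of_nonneg_right hΛ (div_nonneg vonMangoldt_nonneg hm0.le)) ?_
            positivity
    · rw [abs_zero]; have := bumpMass_pos; have : 0 ≤ (Λ m : ℝ) / m := div_nonneg vonMangoldt_nonneg hm0.le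
      positivity
  have hsum := sum_vonMangoldt_div_self_le N
  have h4 : Real.log 4 < 1.3863 := by
    have := Real.log_two_lt_d9
    rw [show (4 : ℝ) = 2 ^ 2 by norm_num, Real.log_pow]; push_cast; linarith
  unfold primePairFull
  calc |∑ m ∈ Finset.Icc 1 N, (if m.Prime then coefR x m * coefR y m else 0)|
      ≤ ∑ m ∈ Finset.Icc 1 N, |(if m.Prime then coefR x m * coefR y m else 0)| := Finset.abs_sum_le_sum_abs _ _
    _ ≤ ∑ m ∈ Finset.Icc 1 N, bumpMass ^ 2 * ((y + 1 / 4) * ((Λ m : ℝ) / m)) := Finset.sum_le_sum hterm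
    _ = bumpMass ^ 2 * ((y + 1 / 4) * ∑ m ∈ Finset.Icc 1 N, (Λ m : ℝ) / m) := by rw [← Finset.mul_sum, ← Finset.mul_sum]
    _ ≤ bumpMass ^ 2 * ((y + 1 / 4) * (2 * Real.log N + 2 * Real.log 4)) := by
        refine mul_le_mul_of_nonneg_left (mul_le_mul_of_nonneg_left hsum (by linarith)) (by positivity)
    _ ≤ 7 * bumpMass ^ 2 := by
        have : (y + 1 / 4) * (2 * Real.log N + 2 * Real.log 4) ≤ 7 := by nlinarith
        nlinarith [sq_nonneg bumpMass]

/-! ## The Abel summation for `y > 1` -/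

/-- Continuity of `h`, `h'`, `F'` pieces. [folklore] -/
theorem continuous_hWeight (x y : ℝ) : Continuous (hWeight x y) := by
  unfold hWeight
  exact (contDiff_g0R.continuous.comp (continuous_id.sub continuous_const)).mul
    (contDiff_g0R.continuous.comp (continuous_id.sub continuous_const))

/-- Continuity of `h'`. [folklore] -/
theorem continuous_hWeightDeriv (x y : ℝ) : Continuous (hWeightDeriv x y) := by
  unfold hWeightDeriv
  have hd : Continuous (deriv g0R) := contDiff_g0R.continuous_deriv (by simp)
  exact ((hd.comp (continuous_id.sub continuous_const)).mul (contDiff_g0R.continuous.comp (continuous_id.sub continuous_const))).add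
    ((contDiff_g0R.continuous.comp (continuous_id.sub continuous_const)).mul (hd.comp (continuous_id.sub continuous_const)))

/-- Continuity of `F'` on `[2, X]`. [folklore] -/
theorem continuousOn_abelFDeriv (x y : ℝ) {a b : ℝ} (ha : 0 < a) : ContinuousOn (abelFDeriv x y) (Icc a b) := by
  unfold abelFDeriv
  refine ContinuousOn.div ?_ (by fun_prop) fun t ht ↦ pow_ne_zero _ (by linarith [ht.1] : (0:ℝ) < t).ne'
  have hlog : ContinuousOn Real.log (Icc a b) := Real.continuousOn_log.mono fun t ht ↦ by
    simp only [Set.mem_compl_iff, Set.mem_singleton_iff]; have := ht.1; linarith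
  exact (((continuous_hWeightDeriv x y).comp_continuousOn hlog).mul hlog).add
    (((continuous_hWeight x y).comp_continuousOn hlog).mul (continuousOn_const.sub hlog))

/-- Continuity of `F` on `[a, b]`, `a > 0`. [folklore] -/
theorem continuousOn_abelF (x y : ℝ) {a b : ℝ} (ha : 0 < a) : ContinuousOn (abelF x y) (Icc a b) := by
  unfold abelF
  have hlog : ContinuousOn Real.log (Icc a b) := Real.continuousOn_log.mono fun t ht ↦ by
    simp only [Set.mem_compl_iff, Set.mem_singleton_iff]; have := ht.1; linarith
  exact (hlog.div continuousOn_id fun t ht ↦ (by linarith [ht.1] : (0:ℝ) < t).ne').mul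
    ((continuous_hWeight x y).comp_continuousOn hlog)

/-- `|F'(t)| ≤ (H₀ + H₁)(1 + log t)/t²` for `t ≥ 1`. [folklore] -/
theorem abs_abelFDeriv_le (x y : ℝ) {t : ℝ} (ht : 1 ≤ t) :
    |abelFDeriv x y t| ≤ (bumpMass ^ 2 + 2 * bumpMass * derivBound) * (1 + Real.log t) / t ^ 2 := by
  unfold abelFDeriv
  have hlog : 0 ≤ Real.log t := Real.log_nonneg ht
  have h1 := abs_hWeightDeriv_le x y (Real.log t)
  obtain ⟨h2, h3⟩ := hWeight_mem x y (Real.log t)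
  rw [abs_div, abs_of_pos (by positivity : (0 : ℝ) < t ^ 2)]
  refine div_le_div_of_nonneg_right ?_ (by positivity)
  calc |hWeightDeriv x y (Real.log t) * Real.log t + hWeight x y (Real.log t) * (1 - Real.log t)|
      ≤ |hWeightDeriv x y (Real.log t)| * Real.log t + hWeight x y (Real.log t) * |1 - Real.log t| := by
        refine (abs_add_le _ _).trans (le_of_eq ?_)
        rw [abs_mul, abs_mul, abs_of_nonneg hlog, abs_of_nonneg h2]
    _ ≤ (2 * bumpMass * derivBound) * Real.log t + bumpMass ^ 2 * (1 + Real.log t) := by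
        refine add_le_add (mul_le_mul_of_nonneg_right h1 hlog) (mul_le_mul h3 ?_ (abs_nonneg _) (by positivity))
        rcases abs_cases (1 - Real.log t) with ⟨h, _⟩ | ⟨h, _⟩ <;> linarith
    _ ≤ (bumpMass ^ 2 + 2 * bumpMass * derivBound) * (1 + Real.log t) := by
        have hb := bumpMass_pos; have hd := derivBound_spec.1
        nlinarith [mul_nonneg (mul_nonneg (by norm_num : (0:ℝ) ≤ 2) hb.le) hd, sq_nonneg bumpMass]

/-- `F'(t) = 0` for `0 < t < e^{y − 1/4}`. [folklore] -/
theorem abelFDeriv_eq_zero (x y : ℝ) {t : ℝ} (ht : 0 < t) (hty : t < Real.exp (y - 1 / 4)) : abelFDeriv x y t = 0 := by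
  unfold abelFDeriv
  have hlt : Real.log t < y - 1 / 4 := by rwa [Real.log_lt_iff_lt_exp ht]
  have habs : 1 / 4 < |Real.log t - y| := by rw [abs_of_neg (by linarith)]; linarith
  rw [hWeightDeriv_eq_zero habs, hWeight_eq_zero habs.le]; simp

/-- **The prime pair sum by partial summation** (Rudnick–Sarnak 1996, (3.66)–(3.68), from the prime
number theorem with error `O(t/log²t)`): uniformly in `x` and `y ≥ 0`,
`|𝒫(x, y) − y K(x − y)| ≤ C_𝒫`. [cite: RudnickSarnak1996, (3.66)–(3.68)] -/
theorem abs_primePairFull_sub_le (x : ℝ) {y : ℝ} (hy : 0 ≤ y) :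
    |primePairFull x y - y * Kfun (x - y)| ≤ primePairConst := by
  classical
  have hbm := bumpMass_pos; have hk0 := ker_zero_pos; have hdb := derivBound_spec.1
  obtain ⟨hB0, hB⟩ := Classical.choose_spec (exists_abs_theta_sub_le_div_log_pow 2)
  set B := Classical.choose (exists_abs_theta_sub_le_div_log_pow 2)
  have hKb : y * Kfun (x - y) ≤ y * (bumpMass * ker 0) := mul_le_mul_of_nonneg_left (Kfun_le _) hy
  have hK0 : 0 ≤ y * Kfun (x - y) := mul_nonneg hy (Kfun_nonneg _)
  by_cases hy1 : y ≤ 1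
  · -- small `y`
    have h1 := abs_primePairFull_le_of_le_one x hy hy1
    have h2 : y * Kfun (x - y) ≤ bumpMass * ker 0 := hKb.trans (mul_le_of_le_one_left (by positivity) hy1)
    unfold primePairConst
    rw [abs_le] at h1 ⊢
    constructor <;> nlinarith [mul_nonneg hB0 (by positivity : (0:ℝ) ≤ bumpMass ^ 2 + 2 * bumpMass * derivBound)]
  push Not at hy1
  -- notation
  set N := suppBound y
  set X := Real.exp (y + 1 / 4) with hXdef
  have hXpos : 0 < X := Real.exp_pos _
  have hX2 : 2 ≤ X := by have := Real.add_one_le_exp (y + 1 / 4); linarith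
  have hNX : ⌊X⌋₊ = N := rfl
  have hN2 : 2 ≤ N := by rw [← hNX]; exact Nat.le_floor (by exact_mod_cast hX2)
  have hlogX : Real.log X = y + 1 / 4 := Real.log_exp _
  set m := Real.exp (y - 1 / 4) with hmdef
  have hm2 : 2 < m := by
    have h1 : Real.exp (3 / 4 : ℝ) ≤ m := Real.exp_le_exp.2 (by linarith)
    have h2 : (2 : ℝ) < Real.exp (3 / 4) := by
      have := Real.quadratic_le_exp_of_nonneg (by norm_num : (0:ℝ) ≤ 3 / 4); nlinarith
    linarith
  have hmX : m ≤ X := Real.exp_le_exp.2 (by linarith)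
  have hlogm : Real.log m = y - 1 / 4 := Real.log_exp _
  set c : ℕ → ℝ := fun k ↦ if k.Prime then Real.log k else 0 with hc
  have hS : ∀ t : ℝ, ∑ k ∈ Finset.Icc 0 ⌊t⌋₊, c k = θ t := fun t ↦ by
    rw [Chebyshev.theta_eq_sum_Icc, Finset.sum_filter]
  set F := abelF x y with hF
  set F' := abelFDeriv x y with hF'
  set H : ℝ := bumpMass ^ 2 + 2 * bumpMass * derivBound
  have hH0 : 0 ≤ H := by positivity
  -- Step 1: the sum in Abel form
  have hstep1 : primePairFull x y = ∑ k ∈ Finset.Icc 1 N, F k * c k := by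
    unfold primePairFull
    refine Finset.sum_congr rfl fun k _ ↦ ?_
    simp only [c]
    split_ifs with hp
    · exact coefR_mul_coefR_prime x y hp
    · rw [mul_zero]
  -- Step 2: split off `k ≤ 2`
  have hstep2 : ∑ k ∈ Finset.Icc 1 N, F k * c k = F 2 * Real.log 2 + ∑ k ∈ Finset.Ioc 2 N, F k * c k := by
    have e : Finset.Icc 1 N = Finset.Ioc 0 N := by
      ext k; simp [Finset.mem_Icc, Finset.mem_Ioc, Nat.one_le_iff_ne_zero, Nat.pos_iff_ne_zero]
    rw [e, ← Finset.sum_Ioc_consecutive _ (Nat.zero_le 2) hN2]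
    congr 1
    rw [show Finset.Ioc 0 2 = {1, 2} by decide, Finset.sum_pair (by norm_num)]
    simp only [c, Nat.not_prime_one, if_false, mul_zero, zero_add, Nat.prime_two, if_true, Nat.cast_ofNat]
  -- Step 3: Abel summation on `[2, X]`
  have hdiff : ∀ t ∈ Set.Icc 2 X, DifferentiableAt ℝ F t := fun t ht ↦
    (hasDerivAt_abelF x y (by linarith [ht.1])).differentiableAt
  have hderiv : ∀ t ∈ Set.Icc 2 X, deriv F t = F' t := fun t ht ↦ (hasDerivAt_abelF x y (by linarith [ht.1])).deriv
  have hint : IntegrableOn (deriv F) (Set.Icc 2 X) :=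
    ((continuousOn_abelFDeriv x y (by norm_num : (0:ℝ) < 2)).integrableOn_Icc).congr_fun
      (fun t ht ↦ (hderiv t ht).symm) measurableSet_Icc
  have habel := sum_mul_eq_sub_sub_integral_mul c (by norm_num : (0 : ℝ) ≤ 2) hX2 hdiff hint
  have hfl2 : ⌊(2 : ℝ)⌋₊ = 2 := by norm_num
  rw [hfl2, hNX] at habel
  have hFX : F X = 0 := by
    simp only [hF, abelF]
    rw [hlogX, hWeight_eq_zero (by rw [show y + 1 / 4 - y = 1 / 4 by ring]; norm_num), mul_zero]
  have hsum2 : ∑ k ∈ Finset.Icc 0 2, c k = Real.log 2 := by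
    rw [show Finset.Icc 0 2 = {0, 1, 2} by decide]
    rw [Finset.sum_insert (by decide), Finset.sum_pair (by norm_num)]
    simp only [c, Nat.not_prime_zero, Nat.not_prime_one, if_false, Nat.prime_two, if_true, Nat.cast_ofNat, zero_add]
  rw [hFX, zero_mul, zero_sub, hsum2] at habel
  have hintegral : ∫ t in Set.Ioc 2 X, deriv F t * ∑ k ∈ Finset.Icc 0 ⌊t⌋₊, c k = ∫ t in Set.Ioc 2 X, F' t * θ t := by
    refine setIntegral_congr_fun measurableSet_Ioc fun t ht ↦ ?_
    rw [hderiv t ⟨ht.1.le, ht.2⟩, hS]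
  rw [hintegral] at habel
  -- so `𝒫 = -∫ F' θ`
  have hPP : primePairFull x y = -∫ t in Set.Ioc 2 X, F' t * θ t := by
    rw [hstep1, hstep2, habel]; ring
  -- Step 4: split `θ = t + (θ - t)`
  have hF'c : ContinuousOn F' (Icc 2 X) := continuousOn_abelFDeriv x y (by norm_num)
  obtain ⟨MF, hMF⟩ := isCompact_Icc.exists_bound_of_continuousOn hF'c
  have hF'meas : AEStronglyMeasurable F' (volume.restrict (Set.Ioc 2 X)) :=
    (hF'c.mono Set.Ioc_subset_Icc_self).aestronglyMeasurable measurableSet_Ioc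
  have hI1 : IntegrableOn (fun t ↦ F' t * t) (Set.Ioc 2 X) :=
    ((hF'c.mul continuousOn_id).integrableOn_Icc).mono_set Set.Ioc_subset_Icc_self
  have hI2 : IntegrableOn (fun t ↦ F' t * (θ t - t)) (Set.Ioc 2 X) := by
    refine Integrable.mono' (g := fun _ ↦ MF * (3 * X))
      ((continuous_const.integrableOn_Icc (a := (2:ℝ)) (b := X)).mono_set Set.Ioc_subset_Icc_self) ?_ ?_
    · exact hF'meas.mul ((measurable_theta.sub measurable_id).aestronglyMeasurable)
    · rw [ae_restrict_iff' measurableSet_Ioc]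
      refine Eventually.of_forall fun t ht ↦ ?_
      rw [norm_mul, Real.norm_eq_abs, Real.norm_eq_abs]
      have h1 := hMF t ⟨ht.1.le, ht.2⟩
      rw [Real.norm_eq_abs] at h1
      have h2 := abs_theta_sub_self_le (by linarith [ht.1] : (0:ℝ) ≤ t)
      exact mul_le_mul h1 (h2.trans (by linarith [ht.2])) (abs_nonneg _) ((abs_nonneg _).trans h1)
  have hsplit : ∫ t in Set.Ioc 2 X, F' t * θ t = (∫ t in Set.Ioc 2 X, F' t * t) + ∫ t in Set.Ioc 2 X, F' t * (θ t - t) := by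
    rw [← integral_add hI1 hI2]
    exact setIntegral_congr_fun measurableSet_Ioc fun t _ ↦ by ring
  -- Step 5: `∫ F' t = -2 F(2) - ∫ F`  (integration by parts)
  have hIBP : ∫ t in Set.Ioc 2 X, F' t * t = -(2 * F 2) - ∫ t in (2:ℝ)..X, F t := by
    rw [← intervalIntegral.integral_of_le hX2]
    have hu : ∀ t ∈ Set.uIcc 2 X, HasDerivAt F (F' t) t := fun t ht ↦ by
      rw [Set.uIcc_of_le hX2] at ht; exact hasDerivAt_abelF x y (by linarith [ht.1])
    have hv : ∀ t ∈ Set.uIcc 2 X, HasDerivAt (fun s : ℝ ↦ s) 1 t := fun t _ ↦ hasDerivAt_id t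
    have hu' : IntervalIntegrable F' volume 2 X := by
      refine ContinuousOn.intervalIntegrable ?_; rw [Set.uIcc_of_le hX2]; exact hF'c
    have hv' : IntervalIntegrable (fun _ : ℝ ↦ (1 : ℝ)) volume 2 X := intervalIntegrable_const
    have h := intervalIntegral.integral_mul_deriv_eq_deriv_mul hu hv hu' hv'
    simp only [mul_one] at h
    rw [hFX] at h
    linarith
  -- Step 6: `∫_2^X F = ∫ u h(u) du` over `ℝ`
  have hsubst : ∫ t in (2:ℝ)..X, F t = ∫ u in Real.log 2..Real.log X, u * hWeight x y u := by
    have h1 : ∀ t ∈ Set.uIcc 2 X, HasDerivAt Real.log t⁻¹ t := fun t ht ↦ by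
      rw [Set.uIcc_of_le hX2] at ht; exact Real.hasDerivAt_log (by linarith [ht.1])
    have h2 : ContinuousOn (fun t : ℝ ↦ t⁻¹) (Set.uIcc 2 X) := by
      rw [Set.uIcc_of_le hX2]; exact continuousOn_inv₀.mono fun t ht ↦ by
        simp only [Set.mem_compl_iff, Set.mem_singleton_iff]; linarith [ht.1]
    have h3 := intervalIntegral.integral_comp_mul_deriv h1 h2 (continuous_id.mul (continuous_hWeight x y))
    calc ∫ t in (2:ℝ)..X, F t = ∫ t in (2:ℝ)..X, (((id : ℝ → ℝ) * hWeight x y) ∘ Real.log) t * t⁻¹ := by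
          refine intervalIntegral.integral_congr fun t _ ↦ ?_
          simp only [hF, abelF, Function.comp_apply, Pi.mul_apply, id]
          ring
      _ = ∫ u in Real.log 2..Real.log X, ((id : ℝ → ℝ) * hWeight x y) u := h3
      _ = _ := rfl
  have hsupp : Function.support (fun u ↦ u * hWeight x y u) ⊆ Set.Ioc (Real.log 2) (Real.log X) := by
    intro u hu
    rw [Function.mem_support] at hu
    have hh : hWeight x y u ≠ 0 := fun h ↦ hu (by rw [h, mul_zero])
    have habs : |u - y| < 1 / 4 := by
      by_contra h; push Not at h; exact hh (hWeight_eq_zero h)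
    rw [abs_lt] at habs
    rw [hlogX]
    have hl2 : Real.log 2 < 0.6931471808 := Real.log_two_lt_d9
    exact ⟨by linarith, by linarith⟩
  have hwhole : ∫ u in Real.log 2..Real.log X, u * hWeight x y u = ∫ u, u * hWeight x y u :=
    intervalIntegral.integral_eq_integral_of_support_subset hsupp
  -- the whole-line integral: `y K + ∫ (u - y) h`
  have hih : Integrable (hWeight x y) := by
    have h := (integrable_g0R.comp_sub_right y).bdd_mul (c := bumpMass) (f := fun u ↦ g0R (u - x))
      (contDiff_g0R.continuous.comp (continuous_id.sub continuous_const)).aestronglyMeasurable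
      (Eventually.of_forall fun u ↦ by rw [Real.norm_eq_abs, abs_of_nonneg (g0R_nonneg _)]; exact g0R_le _)
    exact h
  have hih2 : Integrable fun u ↦ (u - y) * hWeight x y u := by
    have h := (integrable_g0R.comp_sub_right x).bdd_mul (c := bumpMass / 4) (f := fun u ↦ (u - y) * g0R (u - y))
      ((continuous_id.sub continuous_const).mul (contDiff_g0R.continuous.comp (continuous_id.sub continuous_const))).aestronglyMeasurable
      (Eventually.of_forall fun u ↦ by
        rw [Real.norm_eq_abs, abs_mul, abs_of_nonneg (g0R_nonneg _)]
        by_cases hu : 1 / 4 ≤ |u - y|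
        · rw [g0R_eq_zero hu, mul_zero]; positivity
        · push Not at hu
          calc |u - y| * g0R (u - y) ≤ (1 / 4) * bumpMass := mul_le_mul hu.le (g0R_le _) (g0R_nonneg _) (by norm_num)
            _ = bumpMass / 4 := by ring)
    refine h.congr (Eventually.of_forall fun u ↦ ?_)
    simp only [hWeight]; ring
  have hdecomp : ∫ u, u * hWeight x y u = y * Kfun (x - y) + ∫ u, (u - y) * hWeight x y u := by
    rw [← integral_g0R_sub_mul_g0R_sub x y, ← integral_const_mul,
      show (fun a : ℝ ↦ y * (g0R (a - x) * g0R (a - y))) = fun u ↦ y * hWeight x y u from rfl,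
      ← integral_add (hih.const_mul y) hih2]
    congr 1 with u
    ring
  have herr1 : |∫ u, (u - y) * hWeight x y u| ≤ bumpMass * ker 0 / 4 := by
    calc |∫ u, (u - y) * hWeight x y u| ≤ ∫ u, |(u - y) * hWeight x y u| := by
          have := norm_integral_le_integral_norm (fun u ↦ (u - y) * hWeight x y u) (μ := volume)
          simpa only [Real.norm_eq_abs] using this
      _ ≤ ∫ u, bumpMass / 4 * g0R (u - y) := by
          refine integral_mono_of_nonneg (Eventually.of_forall fun u ↦ abs_nonneg _)
            ((integrable_g0R.comp_sub_right y).const_mul _) (Eventually.of_forall fun u ↦ ?_)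
          dsimp only
          rw [abs_mul, abs_of_nonneg (hWeight_mem x y u).1]
          by_cases hu : 1 / 4 ≤ |u - y|
          · rw [hWeight_eq_zero hu, mul_zero]; exact mul_nonneg (by positivity) (g0R_nonneg _)
          · push Not at hu
            calc |u - y| * hWeight x y u ≤ (1 / 4) * (bumpMass * g0R (u - y)) :=
                  mul_le_mul hu.le (hWeight_le' x y u) (hWeight_mem x y u).1 (by norm_num)
              _ = bumpMass / 4 * g0R (u - y) := by ring
      _ = bumpMass * ker 0 / 4 := by
          rw [integral_const_mul, integral_sub_right_eq_self g0R y, integral_g0R]; ring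
  have herr2 : |2 * F 2| ≤ bumpMass ^ 2 := by
    simp only [hF, abelF]
    have hl2 : Real.log 2 < 0.6931471808 := Real.log_two_lt_d9
    have hl0 : 0 < Real.log 2 := Real.log_pos one_lt_two
    obtain ⟨h0, h1⟩ := hWeight_mem x y (Real.log 2)
    rw [abs_of_nonneg (by positivity)]
    calc 2 * (Real.log 2 / 2 * hWeight x y (Real.log 2)) = Real.log 2 * hWeight x y (Real.log 2) := by ring
      _ ≤ 1 * bumpMass ^ 2 := mul_le_mul (by linarith) h1 h0 (by norm_num)
      _ = bumpMass ^ 2 := one_mul _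
  -- Step 7: the error integral
  have herr3 : |∫ t in Set.Ioc 2 X, F' t * (θ t - t)| ≤ 2 * B * H := by
    set G : ℝ → ℝ := Set.indicator (Set.Ici m) fun t ↦ 4 * B * H / t
    have hGint : IntegrableOn G (Set.Ioc 2 X) := by
      refine IntegrableOn.indicator ?_ measurableSet_Ici
      refine (ContinuousOn.integrableOn_Icc ?_).mono_set Set.Ioc_subset_Icc_self
      exact ContinuousOn.div continuousOn_const continuousOn_id fun t ht ↦ (by linarith [ht.1] : (0:ℝ) < t).ne'
    have hpt : ∀ t ∈ Set.Ioc 2 X, |F' t * (θ t - t)| ≤ G t := by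
      intro t ht
      have ht0 : 0 < t := by linarith [ht.1]
      simp only [G, Set.indicator_apply, Set.mem_Ici]
      split_ifs with hmt
      · rw [abs_mul]
        have h1 := abs_abelFDeriv_le x y (by linarith [ht.1] : (1:ℝ) ≤ t)
        have h2 := hB t ht.1.le
        have hlog2 : 0 < Real.log t := Real.log_pos (by linarith [ht.1])
        have h3 := one_add_log_le ht.1.le
        calc |F' t| * |θ t - t| ≤ (H * (1 + Real.log t) / t ^ 2) * (B * t / Real.log t ^ 2) :=
              mul_le_mul h1 h2 (abs_nonneg _) (by positivity)
          _ = B * H * ((1 + Real.log t) / Real.log t ^ 2) / t := by field_simp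
          _ ≤ B * H * 4 / t := by
              refine div_le_div_of_nonneg_right (mul_le_mul_of_nonneg_left ?_ (by positivity)) ht0.le
              rw [div_le_iff₀ (by positivity)]; linarith
          _ = 4 * B * H / t := by ring
      · push Not at hmt
        rw [show F' t = 0 from abelFDeriv_eq_zero x y ht0 hmt, zero_mul, abs_zero]
    calc |∫ t in Set.Ioc 2 X, F' t * (θ t - t)| ≤ ∫ t in Set.Ioc 2 X, |F' t * (θ t - t)| := by
          have := norm_integral_le_integral_norm (fun t ↦ F' t * (θ t - t)) (μ := volume.restrict (Set.Ioc 2 X))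
          simpa only [Real.norm_eq_abs] using this
      _ ≤ ∫ t in Set.Ioc 2 X, G t := by
          refine setIntegral_mono_on hI2.norm hGint measurableSet_Ioc fun t ht ↦ ?_
          simpa only [Real.norm_eq_abs] using hpt t ht
      _ = ∫ t in Set.Icc m X, 4 * B * H / t := by
          have hset : Set.Ioc 2 X ∩ Set.Ici m = Set.Icc m X := by
            ext t
            simp only [Set.mem_inter_iff, Set.mem_Ioc, Set.mem_Ici, Set.mem_Icc]
            constructor
            · rintro ⟨⟨_, h2⟩, h3⟩; exact ⟨h3, h2⟩
            · rintro ⟨h1, h2⟩; exact ⟨⟨by linarith, h2⟩, h1⟩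
          simp only [G]
          rw [setIntegral_indicator measurableSet_Ici, hset]
      _ = ∫ t in m..X, 4 * B * H / t := by
          rw [intervalIntegral.integral_of_le hmX, integral_Icc_eq_integral_Ioc]
      _ = 4 * B * H * (Real.log X - Real.log m) := by
          simp_rw [div_eq_mul_inv]
          rw [intervalIntegral.integral_const_mul, integral_inv_of_pos (by linarith) hXpos, Real.log_div hXpos.ne' (by linarith)]
      _ = 2 * B * H := by rw [hlogX, hlogm]; ring
  -- assemble
  have hmain : primePairFull x y - y * Kfun (x - y) =
      (∫ u, (u - y) * hWeight x y u) + 2 * F 2 - ∫ t in Set.Ioc 2 X, F' t * (θ t - t) := by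
    rw [hPP, hsplit, hIBP, hsubst, hwhole, hdecomp]; ring
  rw [hmain]
  unfold primePairConst
  calc |(∫ u, (u - y) * hWeight x y u) + 2 * F 2 - ∫ t in Set.Ioc 2 X, F' t * (θ t - t)|
      ≤ |∫ u, (u - y) * hWeight x y u| + |2 * F 2| + |∫ t in Set.Ioc 2 X, F' t * (θ t - t)| := by
        refine (abs_sub _ _).trans (add_le_add (abs_add_le _ _) le_rfl)
    _ ≤ bumpMass * ker 0 / 4 + bumpMass ^ 2 + 2 * B * H := add_le_add (add_le_add herr1 herr2) herr3
    _ ≤ _ := by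
        simp only [H]
        nlinarith [mul_nonneg hbm.le hk0.le, sq_nonneg bumpMass]

end RudnickSarnakN

end Literature.NumberTheory.LFunctions

end
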